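import Summits.NavierStokesRegularity.FunctionalMining.VorticityL6Production

/-!
# FunctionalMining — K0 row `E.q=6|T_LD|G1` HOLDS (∃κ): the `Z₆ = ∫|ω|⁶` saturating law in the kernel

Search for candidate a priori estimates; no regularity claim.

Sequel of `VorticityL6Production`. The exact `Z₆` balance of the tree
(`IsClassicalNSSolutionOn.hasDerivWithinAt_integral_torusVorticitySqAt_pow`, `m = 3`; Gibbon 2010
App. A) reads, on `T³` and for the unforced system,
`Ż₆ = 6∫|ω|⁴σ − ν(3∫|ω|⁴∑ₖ∑ᵢⱼ(∂ₖWᵢⱼ)² + 6∫|ω|²∑ₖ(∂ₖ|ω|²)²)`; with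
`∑ᵢⱼ(∂ₖWᵢⱼ)² = 2‖∂ₖω‖²` (`VorticityL4.sum_partialDeriv_vorticityTensor_sq`) and the second viscous
term dropped, `Ż₆ ≤ 6X − 6νI`, `X = ∫|ω|⁴σ`, `I = ∫‖ω‖⁴∑ₖ‖∂ₖω‖²`. The static bound
`|X|²⁴ ≤ K' Z₆¹⁰ Z⁹ I¹⁵` (`VorticityL6.production6_bound`) and Young at the weights `(5/8, 3/8)`
give `6|X| ≤ 6νI + (9/4) c ν^{−5/3} Z Z₆^{10/9}`, `c⁹ = K'(5/8)¹⁵`, i.e. the saturating law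
`T_LD` with `σ = 9`, `γ = 5/3` — the exponents of SIEVELD §3.2 at `q = 6`
(`σ = 2q − 3`, `γ = (3q−3)/(2q−3)`).

## Main statements

* `le_of_pow_24_le` — Young: `N²⁴ ≤ x¹⁵y⁹ ⟹ N ≤ (5/8)x + (3/8)y`.
* `viscous6_term_eq`, `derivWithin_Z6_le` — the slice form `Ż₆ ≤ 6X − 6νI` on `T³`.
* `torusVorticityMoment_six` — `Z₆ = ∫(|ω|²)³`.
* `vorticityL6_saturatingLaw` — `∃ κ, SaturatingLaw (d := Fin 3) (torusVorticityMoment 6) 9 (5/3) κ`.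
-/

noncomputable section

open MeasureTheory Finset Set
open scoped InnerProductSpace RealInnerProductSpace ContDiff

namespace Summit.NavierStokesRegularity.FunctionalMining

open Literature.Analysis.FunctionSpaces Literature.Analysis.FunctionSpaces.Torus
  Literature.Analysis.FluidPDE

namespace VorticityL6

open VorticityL4

variable {d : Type*} [Fintype d] [DecidableEq d]

/-! ## 1. Young at the weights `(5/8, 3/8)` -/

omit [Fintype d] [DecidableEq d] in
/-- **Young / AM–GM at the weights `(15/24, 9/24) = (5/8, 3/8)`**: `N²⁴ ≤ x¹⁵ y⁹` with
`N, x, y ≥ 0` gives `N ≤ (5/8) x + (3/8) y`. [folklore] -/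
theorem le_of_pow_24_le {N x y : ℝ} (hN : 0 ≤ N) (hx : 0 ≤ x) (hy : 0 ≤ y)
    (h : N ^ 24 ≤ x ^ 15 * y ^ 9) : N ≤ 5 / 8 * x + 3 / 8 * y := by
  have h24 : N = (N ^ 24) ^ ((24 : ℕ)⁻¹ : ℝ) := (Real.pow_rpow_inv_natCast hN (by norm_num)).symm
  have hmono : (N ^ 24) ^ ((24 : ℕ)⁻¹ : ℝ) ≤ (x ^ 15 * y ^ 9) ^ ((24 : ℕ)⁻¹ : ℝ) :=
    Real.rpow_le_rpow (by positivity) h (by norm_num)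
  have hsplit : (x ^ 15 * y ^ 9) ^ ((24 : ℕ)⁻¹ : ℝ) = x ^ (5 / 8 : ℝ) * y ^ (3 / 8 : ℝ) := by
    rw [Real.mul_rpow (by positivity) (by positivity)]
    congr 1
    · rw [show x ^ 15 = x ^ ((15 : ℕ) : ℝ) from (Real.rpow_natCast x 15).symm, ← Real.rpow_mul hx]
      norm_num
    · rw [show y ^ 9 = y ^ ((9 : ℕ) : ℝ) from (Real.rpow_natCast y 9).symm, ← Real.rpow_mul hy]
      norm_num
  have hAG : x ^ (5 / 8 : ℝ) * y ^ (3 / 8 : ℝ) ≤ (5 / 8) * x + (3 / 8) * y :=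
    Real.geom_mean_le_arith_mean2_weighted (by norm_num) (by norm_num) hx hy (by norm_num)
  rw [h24]
  exact hmono.trans (hsplit.le.trans hAG)

/-! ## 2. The `Z₆` balance at a time slice -/

/-- On `T³`, the first viscous term of the `Z₆` balance is twice the weighted gradient integral of
`ω = curl v`: `∫|ω|⁴∑ₖ∑ᵢⱼ(∂ₖWᵢⱼ)² = 2∫‖ω‖⁴∑ₖ‖∂ₖω‖²`. [folklore] -/
theorem viscous6_term_eq {v : UnitAddTorus (Fin 3) → EuclideanSpace ℝ (Fin 3)} (hv : IsSmooth v) :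
    ∫ x, torusVorticitySqAt v x ^ 2 *
        ∑ k, ∑ i, ∑ j, partialDeriv k (torusVorticityTensor v i j) x ^ 2 =
      2 * ∫ x, ‖BDSV.curl v x‖ ^ 4 * ∑ k, ‖partialDeriv k (BDSV.curl v) x‖ ^ 2 := by
  rw [← integral_const_mul]
  refine integral_congr_ae (ae_of_all _ fun x => ?_)
  simp only [sum_partialDeriv_vorticityTensor_sq hv, vorticitySqAt_pow_eq]
  rw [← Finset.mul_sum]
  ring

/-- **Slice form of the exact `Z₆` balance on `T³`** (tree
`hasDerivWithinAt_integral_torusVorticitySqAt_pow`, `m = 3`, unforced; Gibbon 2010 App. A):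
along a classical solution on `[a, b] × T³` with `ν ≥ 0`, `s ↦ ∫|ω(s)|⁶` is differentiable within
`[a, b]` at `t` and `d/dt ∫|ω|⁶ ≤ 6∫|ω|⁴σ − 6ν∫‖ω‖⁴∑ₖ‖∂ₖω‖²`, `ω = curl u(t)` (the second
viscous term `−6ν∫|ω|²∑ₖ(∂ₖ|ω|²)²` is dropped; the first is `viscous6_term_eq`).
[cite: Gibbon2010, Appendix A (proof of Prop. 1), opening identity] -/
theorem derivWithin_Z6_le {a b ν : ℝ} (hab : a < b) (hν : 0 ≤ ν)
    {u : ℝ → UnitAddTorus (Fin 3) → EuclideanSpace ℝ (Fin 3)} {p : ℝ → UnitAddTorus (Fin 3) → ℝ}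
    (hsol : IsClassicalNSSolutionOn (Icc a b) ν 0 u p) {t : ℝ} (ht : t ∈ Icc a b) :
    DifferentiableWithinAt ℝ (fun s => ∫ x, torusVorticitySqAt (u s) x ^ 3) (Icc a b) t ∧
      derivWithin (fun s => ∫ x, torusVorticitySqAt (u s) x ^ 3) (Icc a b) t ≤
        6 * (∫ x, torusVorticitySqAt (u t) x ^ 2 * torusStretchingDensity (u t) x) -
          6 * ν * ∫ x, ‖BDSV.curl (u t) x‖ ^ 4 * ∑ k, ‖partialDeriv k (BDSV.curl (u t)) x‖ ^ 2 := by
  have hut : IsSmooth (u t) := hsol.smooth_velocity.isSmooth_slice ht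
  have hD := hsol.hasDerivWithinAt_integral_torusVorticitySqAt_pow hab 3 ht
  have hUD : UniqueDiffWithinAt ℝ (Icc a b) t := uniqueDiffOn_Icc hab t ht
  refine ⟨hD.differentiableWithinAt, ?_⟩
  rw [hD.derivWithin hUD]
  obtain ⟨X, hX⟩ : ∃ X : ℝ, X = ∫ x, torusVorticitySqAt (u t) x ^ 2 *
      torusStretchingDensity (u t) x := ⟨_, rfl⟩
  obtain ⟨I, hI⟩ : ∃ I : ℝ, I = ∫ x, ‖BDSV.curl (u t) x‖ ^ 4 *
      ∑ k, ‖partialDeriv k (BDSV.curl (u t)) x‖ ^ 2 := ⟨_, rfl⟩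
  obtain ⟨I₂, hI₂⟩ : ∃ I₂ : ℝ, I₂ = ∫ x, torusVorticitySqAt (u t) x ^ (3 - 2) *
      ∑ k, partialDeriv k (torusVorticitySqAt (u t)) x ^ 2 := ⟨_, rfl⟩
  have hI₂0 : 0 ≤ I₂ := by
    rw [hI₂]
    exact integral_nonneg fun x => mul_nonneg (pow_nonneg (torusVorticitySqAt_nonneg _ _) _)
      (Finset.sum_nonneg fun k _ => sq_nonneg _)
  have hV1 : ∫ x, torusVorticitySqAt (u t) x ^ (3 - 1) * ∑ k, ∑ i, ∑ j,
      partialDeriv k (torusVorticityTensor (u t) i j) x ^ 2 = 2 * I := by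
    rw [hI, ← viscous6_term_eq hut]
  have hS : ∫ x, torusVorticitySqAt (u t) x ^ (3 - 1) * torusStretchingDensity (u t) x = X := by
    rw [hX]
  have hf0 : ∫ x, torusVorticitySqAt (u t) x ^ (3 - 1) * ∑ i, ∑ j,
      torusVorticityTensor (u t) i j x *
        (partialDeriv i ((0 : ℝ → UnitAddTorus (Fin 3) → EuclideanSpace ℝ (Fin 3)) t) x j -
          partialDeriv j ((0 : ℝ → UnitAddTorus (Fin 3) → EuclideanSpace ℝ (Fin 3)) t) x i) = 0 := by
    simp only [sum_vorticityTensor_mul_curl_zero_force, mul_zero, integral_zero]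
  rw [hV1, hS, hf0, ← hI₂]
  push_cast
  have hνI₂ : 0 ≤ ν * I₂ := mul_nonneg hν hI₂0
  nlinarith [hνI₂]

/-! ## 3. The saturating law -/

/-- `Z₆` in the matrix's spelling: `torusVorticityMoment 6 v = ∫ (|ω|²)³`. [folklore] -/
theorem torusVorticityMoment_six (v : UnitAddTorus d → EuclideanSpace ℝ d) :
    torusVorticityMoment 6 v = ∫ x, torusVorticitySqAt v x ^ 3 := by
  unfold torusVorticityMoment
  refine integral_congr_ae (ae_of_all _ fun x => ?_)
  show torusVorticitySqAt v x ^ ((6 : ℝ) / 2) = torusVorticitySqAt v x ^ 3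
  rw [show (6 : ℝ) / 2 = ((3 : ℕ) : ℝ) by norm_num, Real.rpow_natCast]

/-- **K0 row `E.q=6|T_LD|G1` HOLDS (∃κ), in the kernel, on `T³ = UnitAddTorus (Fin 3)`.** There
is a constant `κ` such that along every zero-mean classical solution of the unforced Navier–Stokes
equations on `T³` (`ν > 0`), at every time of the window, `s ↦ Z₆(u(s)) = ∫|ω|⁶` is differentiable
within the window and `dZ₆/dt ≤ κ · ν^{−5/3} · (2ℰ) · Z₆^{1+1/9}` — the cell's saturating law
`T_LD` with `σ = 9`, `γ = 5/3` for the vorticity moment `Z₆` (`Candidates.SaturatingLaw`,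
`torusVorticityMoment 6`), the exponents of SIEVELD §3.2 (`σ = 2q−3`, `γ = (3q−3)/(2q−3)`,
`q = 6`). The constant is existential through the tree's mean-zero Sobolev constant and the
Calderón–Zygmund constant at `s = 8`; an a priori inequality, small-data closing only.
[ours; chain of SIEVELD §3.2 (`q = 6`) with tree inputs, cf. Gibbon2010 App. A] -/
theorem vorticityL6_saturatingLaw :
    ∃ κ : ℝ, SaturatingLaw (d := Fin 3) (torusVorticityMoment 6) 9 (5 / 3) κ := by
  obtain ⟨C₆, hC₆0, hC₆⟩ :=
    Torus.exists_integral_norm_pow_six_le_gradNormSq_cube (d := Fin 3) (by simp)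
  obtain ⟨K, hK0, hK⟩ := exists_integral_gradSq_pow_four_le
  obtain ⟨K', hK'⟩ : ∃ K' : ℝ, K' = 4096 * K ^ 6 *
      (32 * (729 * C₆ + (39420 * (3 : ℝ) ^ 3) ^ 3)) ^ 5 := ⟨_, rfl⟩
  have hK'0 : 0 ≤ K' := by rw [hK']; positivity
  -- the rate constant: `κ = (9/4) (K' (5/8)¹⁵)^{1/9}`
  obtain ⟨c, hc⟩ : ∃ c : ℝ, c = (K' * (5 / 8) ^ 15) ^ (1 / 9 : ℝ) := ⟨_, rfl⟩
  have hc0 : 0 ≤ c := by rw [hc]; positivity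
  refine ⟨9 / 4 * c, ?_⟩
  intro _ ν hν a b hab u p hsol hmean t ht
  have hut : IsSmooth (u t) := hsol.smooth_velocity.isSmooth_slice ht
  have hdiv : IsDivFree (u t) := hsol.divFree t ht
  have hF : (fun s => torusVorticityMoment 6 (u s)) =
      fun s => ∫ x, torusVorticitySqAt (u s) x ^ 3 := by
    funext s; exact torusVorticityMoment_six (u s)
  obtain ⟨hdiff, hle⟩ := derivWithin_Z6_le hab hν.le hsol ht
  refine ⟨by rw [hF]; exact hdiff, ?_⟩
  rw [hF]
  show _ ≤ 9 / 4 * c * ν ^ (-(5 / 3 : ℝ)) * (2 * torusEnstrophy (u t)) *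
      (torusVorticityMoment 6 (u t)) ^ (1 + (9 : ℝ)⁻¹)
  -- opaque names for the slice quantities
  obtain ⟨X, hX⟩ : ∃ X : ℝ, X = ∫ x, torusVorticitySqAt (u t) x ^ 2 *
      torusStretchingDensity (u t) x := ⟨_, rfl⟩
  obtain ⟨I, hI⟩ : ∃ I : ℝ, I = ∫ x, ‖BDSV.curl (u t) x‖ ^ 4 *
      ∑ k, ‖partialDeriv k (BDSV.curl (u t)) x‖ ^ 2 := ⟨_, rfl⟩
  obtain ⟨A₆, hA₆⟩ : ∃ A : ℝ, A = ∫ x, ‖BDSV.curl (u t) x‖ ^ 6 := ⟨_, rfl⟩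
  obtain ⟨Z, hZ⟩ : ∃ Z : ℝ, Z = ∫ x, ‖BDSV.curl (u t) x‖ ^ 2 := ⟨_, rfl⟩
  rw [← hX, ← hI] at hle
  have hI0 : 0 ≤ I := by rw [hI]; exact integral_nonneg fun x => by positivity
  have hA₆0 : 0 ≤ A₆ := by rw [hA₆]; exact integral_nonneg fun x => by positivity
  have hZ0 : 0 ≤ Z := by rw [hZ]; exact integral_nonneg fun x => by positivity
  -- `|X|²⁴ ≤ K' A₆¹⁰ Z⁹ I¹⁵`
  have h24 : |X| ^ 24 ≤ K' * A₆ ^ 10 * Z ^ 9 * I ^ 15 := by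
    rw [hK', hX, hA₆, hZ, hI]
    exact production6_bound hC₆0 hC₆ hK hut hdiv
  -- Young: `|X| ≤ (5/8) x + (3/8) y`, `x = (8/5) ν I`, `y = c ν^{-5/3} Z A₆^{10/9}`
  obtain ⟨x, hx⟩ : ∃ x : ℝ, x = 8 / 5 * ν * I := ⟨_, rfl⟩
  obtain ⟨y, hy⟩ : ∃ y : ℝ, y = c * ν ^ (-(5 / 3 : ℝ)) * Z * A₆ ^ (10 / 9 : ℝ) := ⟨_, rfl⟩
  have hx0 : 0 ≤ x := by rw [hx]; positivity
  have hνr : 0 ≤ ν ^ (-(5 / 3 : ℝ)) := Real.rpow_nonneg hν.le _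
  have hy0 : 0 ≤ y := by rw [hy]; positivity
  have hxy : x ^ 15 * y ^ 9 = K' * A₆ ^ 10 * Z ^ 9 * I ^ 15 := by
    have e1 : c ^ 9 = K' * (5 / 8) ^ 15 := by
      rw [hc, ← Real.rpow_natCast, ← Real.rpow_mul (by positivity)]; norm_num
    have e2 : (ν ^ (-(5 / 3 : ℝ))) ^ 9 = (ν ^ 15)⁻¹ := by
      rw [← Real.rpow_natCast, ← Real.rpow_mul hν.le,
        show (-(5 / 3 : ℝ)) * ((9 : ℕ) : ℝ) = -((15 : ℕ) : ℝ) by norm_num,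
        Real.rpow_neg hν.le, Real.rpow_natCast]
    have e3 : (A₆ ^ (10 / 9 : ℝ)) ^ 9 = A₆ ^ 10 := by
      rw [← Real.rpow_natCast, ← Real.rpow_mul hA₆0,
        show (10 / 9 : ℝ) * ((9 : ℕ) : ℝ) = ((10 : ℕ) : ℝ) by norm_num, Real.rpow_natCast]
    have hν15 : ν ^ 15 ≠ 0 := pow_ne_zero 15 hν.ne'
    rw [hx, hy]
    simp only [mul_pow]
    rw [e1, e2, e3]
    field_simp
  have hNle : |X| ≤ 5 / 8 * x + 3 / 8 * y :=
    le_of_pow_24_le (abs_nonneg X) hx0 hy0 (by rw [hxy]; exact h24)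
  -- the budget in closed form
  have hbudget : 9 / 4 * c * ν ^ (-(5 / 3 : ℝ)) * (2 * torusEnstrophy (u t)) *
      (torusVorticityMoment 6 (u t)) ^ (1 + (9 : ℝ)⁻¹) = 9 / 4 * y := by
    have e1 : 2 * torusEnstrophy (u t) = Z := by
      rw [hZ, ← integral_torusVorticitySqAt_eq_two_mul_torusEnstrophy hut hdiv]
      exact integral_congr_ae (ae_of_all _ fun x => (norm_curl_sq (u t) x).symm)
    have e2 : torusVorticityMoment 6 (u t) = A₆ := by
      rw [torusVorticityMoment_six, hA₆]
      exact integral_congr_ae (ae_of_all _ fun x => vorticitySqAt_pow_eq (u t) x 3)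
    rw [e1, e2, show (1 : ℝ) + (9 : ℝ)⁻¹ = 10 / 9 by norm_num, hy]
    ring
  rw [hbudget]
  have hXle : X ≤ |X| := le_abs_self X
  have hxI : 5 / 8 * x = ν * I := by rw [hx]; ring
  nlinarith [hNle, hXle, hxI, hle, hy0]

end VorticityL6

end Summit.NavierStokesRegularity.FunctionalMining
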